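import Mathlib
import Summits.AtomisticToContinuum.FouriersLaw.Theses.PhononMeanFreePath

/-!
# Sketch — crux stmt-AtomisticToContinuum-11811 `IncoherentChannel`, ideator k = 2, round 1

Typed objects and first lemmas for the two idea cards
`common-past-variance-carrier` (A) and `two-horizons-forecast-loss` (B).
Chain of `N+1` sites `0..N`, `P = pinnedChain ω₂ lam β γ`, both baths at `T`,
`μ₀ = P.gibbsMeasure (N+1) T`, `K_t = P.transitionKernel (N+1) T T t`.
-/

noncomputable section

open MeasureTheory Filter Topology
open Literature.MathematicalPhysics.KineticTheory.HeatConduction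

namespace Summit.AtomisticToContinuum.FouriersLaw.Cruxes.IncoherentChannel.Ideator2

/-- the constructed equal-temperature kernel `K_t(z, ·)` of the `(N+1)`-site chain -/
def K (ω₂ lam β γ T : ℝ) (N : ℕ) (t : ℝ) (z : PhaseSpace (N + 1)) : Measure (PhaseSpace (N + 1)) :=
  (pinnedChain ω₂ lam β γ).transitionKernel (N + 1) T T t.toNNReal z

/-- the Gibbs state `μ₀` of the `(N+1)`-site chain at temperature `T` -/
def μ (ω₂ lam β γ T : ℝ) (N : ℕ) : Measure (PhaseSpace (N + 1)) :=
  (pinnedChain ω₂ lam β γ).gibbsMeasure (N + 1) T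

/-- MEAN FORECAST of the far momentum: `v_t(z) = E_z[p_N(t)] = (K_t p_N)(z)` -/
def v (ω₂ lam β γ T : ℝ) (N : ℕ) (t : ℝ) (z : PhaseSpace (N + 1)) : ℝ :=
  ∫ y, y.2 (Fin.last N) ∂(K ω₂ lam β γ T N t z)

/-- forecast of the far kinetic energy: `u_t(z) = E_z[p_N(t)²]` -/
def u (ω₂ lam β γ T : ℝ) (N : ℕ) (t : ℝ) (z : PhaseSpace (N + 1)) : ℝ :=
  ∫ y, (y.2 (Fin.last N)) ^ 2 ∂(K ω₂ lam β γ T N t z)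

/-- FORECAST VARIANCE (conditional variance given the initial microstate, randomness = bath noise only):
`w_t(z) = Var_z(p_N(t)) = u_t(z) - v_t(z)²` -/
def w (ω₂ lam β γ T : ℝ) (N : ℕ) (t : ℝ) (z : PhaseSpace (N + 1)) : ℝ :=
  u ω₂ lam β γ T N t z - (v ω₂ lam β γ T N t z) ^ 2

/-- FORECAST NORM `S_N(t) = ‖K_t p_N‖²_{L²(μ₀)} = E[p_N^{(1)}(t) p_N^{(2)}(t)]` (two bath-noise replicas, common initial condition) -/
def S (ω₂ lam β γ T : ℝ) (N : ℕ) (t : ℝ) : ℝ :=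
  ∫ z, (v ω₂ lam β γ T N t z) ^ 2 ∂(μ ω₂ lam β γ T N)

/-- cross kinetic-energy kernel `C_N(t) = Cov_{μ₀}(p_0², K_t p_N²)` (the crux's `C_N`) -/
def C (ω₂ lam β γ T : ℝ) (N : ℕ) (t : ℝ) : ℝ :=
  (∫ z, (z.2 0) ^ 2 * u ω₂ lam β γ T N t z ∂(μ ω₂ lam β γ T N)) -
    (∫ z, (z.2 0) ^ 2 ∂(μ ω₂ lam β γ T N)) * (∫ z, u ω₂ lam β γ T N t z ∂(μ ω₂ lam β γ T N))

/-- end-to-end momentum correlation `r_N(t) = ⟨p_0, K_t p_N⟩_{μ₀}` (the crux's `r_N`) -/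
def r (ω₂ lam β γ T : ℝ) (N : ℕ) (t : ℝ) : ℝ :=
  ∫ z, z.2 0 * v ω₂ lam β γ T N t z ∂(μ ω₂ lam β γ T N)

/-- COMMON-PAST part `P_N(t) = Cov_{μ₀}(p_0², v_t²) = Cov(p_0(0)², p_N^{(1)}(t)·p_N^{(2)}(t))` -/
def Pcp (ω₂ lam β γ T : ℝ) (N : ℕ) (t : ℝ) : ℝ :=
  (∫ z, (z.2 0) ^ 2 * (v ω₂ lam β γ T N t z) ^ 2 ∂(μ ω₂ lam β γ T N)) -
    (∫ z, (z.2 0) ^ 2 ∂(μ ω₂ lam β γ T N)) * (∫ z, (v ω₂ lam β γ T N t z) ^ 2 ∂(μ ω₂ lam β γ T N))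

/-- VARIANCE channel `B_N(t) = Cov_{μ₀}(p_0², w_t) = C_N − P_N` (the carrier) -/
def B (ω₂ lam β γ T : ℝ) (N : ℕ) (t : ℝ) : ℝ :=
  C ω₂ lam β γ T N t - Pcp ω₂ lam β γ T N t

/-- carré du champ of the mean forecast along the two bath directions:
`Γ_s(y) = 2γT[(∂_{p_0} v_s)² + (∂_{p_N} v_s)²](y)` -/
def Gam (ω₂ lam β γ T : ℝ) (N : ℕ) (s : ℝ) (y : PhaseSpace (N + 1)) : ℝ :=
  2 * γ * T * ((partialP 0 (v ω₂ lam β γ T N s) y) ^ 2 + (partialP (Fin.last N) (v ω₂ lam β γ T N s) y) ^ 2)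

/-! ## Card A — `common-past-variance-carrier` -/

/-- (A1, fixed `N`, identity) FORECAST-VARIANCE DUHAMEL: `w_t = ∫₀^t K_{t-s} Γ_s ds`
(law of total variance along the semigroup: `∂_t w = L w + Γ(v_t)`, `w_0 = 0`). -/
def ForecastVarianceDuhamel : Prop :=
  ∀ ω₂ lam β γ : ℝ, 0 < ω₂ → 0 < lam → 0 < β → 0 < γ → ∀ T : ℝ, 0 < T → ∀ (N : ℕ) (t : ℝ), 0 ≤ t →
    ∀ᵐ z ∂(μ ω₂ lam β γ T N),
      w ω₂ lam β γ T N t z = ∫ s in (0:ℝ)..t, ∫ y, Gam ω₂ lam β γ T N s y ∂(K ω₂ lam β γ T N (t - s) z)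

/-- (A2, fixed `N`, identity) SENSITIVITY BUDGET of the far-momentum forecast:
`∫₀^∞ E_{μ₀}[Γ_s] ds = ‖p_N‖² − lim ‖v_t‖² = T`, i.e. the mean forecast is entirely dissipated through the two baths. -/
def SensitivityBudget : Prop :=
  ∀ ω₂ lam β γ : ℝ, 0 < ω₂ → 0 < lam → 0 < β → 0 < γ → ∀ T : ℝ, 0 < T → ∀ N : ℕ,
    IntegrableOn (fun s : ℝ => ∫ y, Gam ω₂ lam β γ T N s y ∂(μ ω₂ lam β γ T N)) (Set.Ioi 0) ∧
    ∫ s in Set.Ioi (0:ℝ), ∫ y, Gam ω₂ lam β γ T N s y ∂(μ ω₂ lam β γ T N) = T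

/-- (A3 = C⁺ of card A) VARIANCE TRANSPORT LAW: the covariance of the initial LEFT kinetic energy with the
conditional VARIANCE of the far momentum carries Fourier's law:
`N (γ²/T²) ∫₀^∞ Cov_{μ₀}(p_0², Var(p_N(t) | z_0)) dt → κ(T) > 0`. -/
def VarianceTransportLaw : Prop :=
  ∀ ω₂ lam β γ : ℝ, 0 < ω₂ → 0 < lam → 0 < β → 0 < γ → ∀ T : ℝ, 0 < T → ∃ κ : ℝ, 0 < κ ∧
    (∀ N : ℕ, IntegrableOn (B ω₂ lam β γ T N) (Set.Ioi 0)) ∧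
    Tendsto (fun N : ℕ => (N : ℝ) * (γ ^ 2 / T ^ 2) * ∫ t in Set.Ioi (0:ℝ), B ω₂ lam β γ T N t) atTop (𝓝 κ)

/-- (A4, the complementary stub) MEAN CHANNEL VANISHES: everything routed through the mean forecast `v_t`
— the coherent channel `2r²` and the common-past fluctuation `A = P − 2r²` — is `o(1/N)` in time integral. -/
def MeanChannelVanishes : Prop :=
  ∀ ω₂ lam β γ : ℝ, 0 < ω₂ → 0 < lam → 0 < β → 0 < γ → ∀ T : ℝ, 0 < T →
    (∀ N : ℕ, IntegrableOn (fun t => Pcp ω₂ lam β γ T N t - 2 * (r ω₂ lam β γ T N t) ^ 2) (Set.Ioi 0)) ∧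
    Tendsto (fun N : ℕ => (N : ℝ) * (γ ^ 2 / T ^ 2) *
      ∫ t in Set.Ioi (0:ℝ), (Pcp ω₂ lam β γ T N t - 2 * (r ω₂ lam β γ T N t) ^ 2)) atTop (𝓝 0)

/-- (A5, conjectural structural bonus, "variance-DEP") the variance channel is pointwise non-negative:
more initial energy on the left never LOWERS the forecast uncertainty on the right. -/
def VarianceChannelNonneg : Prop :=
  ∀ ω₂ lam β γ : ℝ, 0 < ω₂ → 0 < lam → 0 < β → 0 < γ → ∀ T : ℝ, 0 < T → ∀ (N : ℕ) (t : ℝ), 0 ≤ t →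
    0 ≤ B ω₂ lam β γ T N t

/-- Shape of card A's line: the crux is the variance transport law plus the vanishing of the mean channels
(pure real analysis: `C − 2r² = (C − P) + (P − 2r²)`, `integral_add`, `Tendsto.add`). PROVED below. -/
def CardA_Shape : Prop :=
  VarianceTransportLaw → MeanChannelVanishes →
    Summit.AtomisticToContinuum.FouriersLaw.Theses.PhononMeanFreePath.IncoherentChannel

/-! ## Card B — `two-horizons-forecast-loss` -/

/-- (B1 = engine, C⁺ of card B) END-MOMENTUM FORECAST LOSS, uniformly in the length:
`‖K_t p_N‖²_{L²(μ₀)} ≤ C e^{−t/τ}` for all `N` and `t ≥ 0` — the thermostatted end momentum becomes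
unpredictable from EXACT initial data at an `N`-independent rate (predictability horizon `τ`; false at
`lam = β = 0`, where the escaped ballistic wave keeps a positive fraction of the forecast norm). -/
def EndMomentumForecastLoss : Prop :=
  ∀ ω₂ lam β γ : ℝ, 0 < ω₂ → 0 < lam → 0 < β → 0 < γ → ∀ T : ℝ, 0 < T → ∃ Cst τ : ℝ, 0 < τ ∧
    ∀ (N : ℕ) (t : ℝ), 0 ≤ t → S ω₂ lam β γ T N t ≤ Cst * Real.exp (-t / τ)

/-- the same statement written over existing declarations only (no sketch-local abbreviation) -/
def EndMomentumForecastLoss' : Prop :=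
  ∀ ω₂ lam β γ : ℝ, 0 < ω₂ → 0 < lam → 0 < β → 0 < γ → ∀ T : ℝ, 0 < T → ∃ Cst τ : ℝ, 0 < τ ∧
    ∀ (N : ℕ) (t : ℝ), 0 ≤ t →
      ∫ z, (∫ y, y.2 (Fin.last N) ∂((pinnedChain ω₂ lam β γ).transitionKernel (N + 1) T T t.toNNReal z)) ^ 2
        ∂((pinnedChain ω₂ lam β γ).gibbsMeasure (N + 1) T) ≤ Cst * Real.exp (-t / τ)

example : EndMomentumForecastLoss = EndMomentumForecastLoss' := rfl

/-- (B2) LOGARITHMIC LIGHT CONE (causality horizon, needed only up to times `A·log N ≪ N/c`):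
before a signal can cross the chain, the cross quantities are negligible even after multiplication by `N`. -/
def LogLightCone : Prop :=
  ∀ ω₂ lam β γ : ℝ, 0 < ω₂ → 0 < lam → 0 < β → 0 < γ → ∀ T : ℝ, 0 < T → ∀ A : ℝ, 0 < A →
    Tendsto (fun N : ℕ => (N : ℝ) * ∫ t in Set.Ioc (0:ℝ) (A * Real.log N),
      (|C ω₂ lam β γ T N t| + (r ω₂ lam β γ T N t) ^ 2 + |Pcp ω₂ lam β γ T N t|)) atTop (𝓝 0)

/-- (B3, fixed `N`, provable-now size) COMMON-PAST BOUND: whatever is routed through the mean forecast is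
controlled by the forecast norm — `r² ≤ T·S` (Cauchy–Schwarz) and `|P| ≤ K_T √S`
(Hölder with `‖p_0²−T‖_{L⁴} = 60^{1/4} T`, `‖v_t‖_{L⁴} ≤ ‖p_N‖_{L⁴} = 3^{1/4} √T` by `L⁴(μ₀)`-contraction of `K_t`). -/
def CommonPastBound : Prop :=
  ∀ ω₂ lam β γ : ℝ, 0 < ω₂ → 0 < lam → 0 < β → 0 < γ → ∀ T : ℝ, 0 < T → ∃ KT : ℝ,
    ∀ (N : ℕ) (t : ℝ), 0 ≤ t →
      (r ω₂ lam β γ T N t) ^ 2 ≤ T * S ω₂ lam β γ T N t ∧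
      |Pcp ω₂ lam β γ T N t| ≤ KT * Real.sqrt (S ω₂ lam β γ T N t)

/-- (B4) what the two horizons give: the mean channels die (card A's complementary stub) AND the route's
rank-2 crux `CoherentDephasing` (since `2r² ≤ 2T·S`). -/
def CardB_Shape : Prop :=
  EndMomentumForecastLoss → LogLightCone → CommonPastBound →
    MeanChannelVanishes ∧ Summit.AtomisticToContinuum.FouriersLaw.Theses.PhononMeanFreePath.CoherentDephasing

/-- (B5) and for THIS crux: with the variance transport law (card A) — or, equivalently under B1–B3,
with the plain transmission law `N(γ²/T²)∫C_N → κ` — the crux follows. -/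
def CardB_Closes : Prop :=
  EndMomentumForecastLoss → LogLightCone → CommonPastBound → VarianceTransportLaw →
    Summit.AtomisticToContinuum.FouriersLaw.Theses.PhononMeanFreePath.IncoherentChannel


/-! ## Static forms (both cards): the predictability functional and the sensitivity thermometer -/

/-- PREDICTABILITY FUNCTIONAL of the far momentum: `Ψ_N(z) = ∫₀^∞ (E_z[p_N(s)])² ds ≥ 0`, `E Ψ_N = ∫ S_N`. -/
def Psi (ω₂ lam β γ T : ℝ) (N : ℕ) (z : PhaseSpace (N + 1)) : ℝ :=
  ∫ s in Set.Ioi (0:ℝ), (v ω₂ lam β γ T N s z) ^ 2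

/-- SENSITIVITY THERMOMETER `Γ_tot(z) = ∫₀^∞ Γ(v_s)(z) ds ≥ 0`, `E Γ_tot = T`; pointwise `Γ_tot = p_N² + L Ψ_N`
(coboundary correction of the far kinetic energy). -/
def GamTot (ω₂ lam β γ T : ℝ) (N : ℕ) (z : PhaseSpace (N + 1)) : ℝ :=
  ∫ s in Set.Ioi (0:ℝ), Gam ω₂ lam β γ T N s z

/-- (static form of the mean channel, Fubini) `∫₀^∞ P_N = Cov_{μ₀}(p_0², Ψ_N)`: the crux's subtraction, plus the
common-past fluctuation, is ONE static Gibbs covariance between the left kinetic energy and the far predictability functional. -/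
def MeanChannelStatic : Prop :=
  ∀ ω₂ lam β γ : ℝ, 0 < ω₂ → 0 < lam → 0 < β → 0 < γ → ∀ T : ℝ, 0 < T → ∀ N : ℕ,
    ∫ t in Set.Ioi (0:ℝ), Pcp ω₂ lam β γ T N t =
      (∫ z, (z.2 0) ^ 2 * Psi ω₂ lam β γ T N z ∂(μ ω₂ lam β γ T N)) -
        (∫ z, (z.2 0) ^ 2 ∂(μ ω₂ lam β γ T N)) * (∫ z, Psi ω₂ lam β γ T N z ∂(μ ω₂ lam β γ T N))

/-- (static form of the variance channel, Fubini on the Duhamel identity) `∫₀^∞ B_N = ∫₀^∞ Cov_{μ₀}(p_0², K_t Γ_tot) dt`: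
the time-integrated variance channel is the plain transmission from `p_0²` to the thermometer `Γ_tot`. -/
def VarianceChannelIsThermometerTransmission : Prop :=
  ∀ ω₂ lam β γ : ℝ, 0 < ω₂ → 0 < lam → 0 < β → 0 < γ → ∀ T : ℝ, 0 < T → ∀ N : ℕ,
    ∫ t in Set.Ioi (0:ℝ), B ω₂ lam β γ T N t =
      ∫ t in Set.Ioi (0:ℝ),
        ((∫ z, (z.2 0) ^ 2 * (∫ y, GamTot ω₂ lam β γ T N y ∂(K ω₂ lam β γ T N t z)) ∂(μ ω₂ lam β γ T N)) -
          (∫ z, (z.2 0) ^ 2 ∂(μ ω₂ lam β γ T N)) * (∫ z, (∫ y, GamTot ω₂ lam β γ T N y ∂(K ω₂ lam β γ T N t z)) ∂(μ ω₂ lam β γ T N)))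

/-! ## The real-analysis glue of card A, proved (guards the typing of `B`, `Pcp`, `r` against the crux). -/

theorem cardA_shape : CardA_Shape := by
  intro hV hM ω₂ lam β γ hω hl hβ hγ T hT
  obtain ⟨κ, hκ, hBint, hBlim⟩ := hV ω₂ lam β γ hω hl hβ hγ T hT
  obtain ⟨hAint, hAlim⟩ := hM ω₂ lam β γ hω hl hβ hγ T hT
  refine ⟨κ, hκ, ?_⟩
  have key : ∀ N : ℕ,
      (N : ℝ) * (γ ^ 2 / T ^ 2) * ∫ t in Set.Ioi (0:ℝ),
        ((∫ z, (z.2 0) ^ 2 * (∫ y, (y.2 (Fin.last N)) ^ 2 ∂((pinnedChain ω₂ lam β γ).transitionKernel (N + 1) T T t.toNNReal z)) ∂((pinnedChain ω₂ lam β γ).gibbsMeasure (N + 1) T)) -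
          (∫ z, (z.2 0) ^ 2 ∂((pinnedChain ω₂ lam β γ).gibbsMeasure (N + 1) T)) *
            (∫ z, (∫ y, (y.2 (Fin.last N)) ^ 2 ∂((pinnedChain ω₂ lam β γ).transitionKernel (N + 1) T T t.toNNReal z)) ∂((pinnedChain ω₂ lam β γ).gibbsMeasure (N + 1) T)) -
          2 * (∫ z, z.2 0 * (∫ y, y.2 (Fin.last N) ∂((pinnedChain ω₂ lam β γ).transitionKernel (N + 1) T T t.toNNReal z)) ∂((pinnedChain ω₂ lam β γ).gibbsMeasure (N + 1) T)) ^ 2)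
      = (N : ℝ) * (γ ^ 2 / T ^ 2) * (∫ t in Set.Ioi (0:ℝ), B ω₂ lam β γ T N t) +
        (N : ℝ) * (γ ^ 2 / T ^ 2) * ∫ t in Set.Ioi (0:ℝ), (Pcp ω₂ lam β γ T N t - 2 * (r ω₂ lam β γ T N t) ^ 2) := by
    intro N
    rw [← mul_add, ← integral_add (hBint N) (hAint N)]
    congr 1
    refine setIntegral_congr_fun measurableSet_Ioi (fun t _ => ?_)
    simp only [B, C, Pcp, r, u, v, K, μ]
    ring
  simp_rw [key]
  simpa using hBlim.add hAlim

end Summit.AtomisticToContinuum.FouriersLaw.Cruxes.IncoherentChannel.Ideator2
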